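import Literature.NumberTheory.EllipticCurves.TunnellThetaCoefficientsProofs
import HarnessLib

/-!
# Two eta-product identities behind Tunnell's Theorem 2 for `g(θ₂ - θ₈)`, by the truncated
# triple product

In the proof of Theorem 2 of Tunnell 1983 (pp. 327–328) the `T(p²)`-eigenvalues of the eigenform
`g(θ₂ - θ₈) ∈ S_{3/2}(128, 1)` (the part of `g θ₂` living on `n ≡ 3 (mod 8)`) are identified with
`a_p(E)`, `E : y² = x³ - x`, through Shimura's correspondence. The tree replaces that input by an
elementary route through the eta products `g(θ₂ - θ₈) = 2 η(8z) η(32z)²` and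
`φ = η(4z)² η(8z)²` (the newform of level `32` attached to `E`), and this file supplies the two
`q`-series identities it needs, as identities of integer formal power series in `W = q⁴` between
products of the theta series `θ_{a,b,s} = ∑_m s^{|m|} W^{a m² + b m}` of
`TunnellThetaCoefficientsProofs` (`thetaSeries b e s`, `a = b + e`):

* `thetaSeries_classThree_eq` (**`g(θ₂ - θ₈) = 2 η(8z) η(32z)²`**):
  `θ_{4,2,+} · θ_{2,0,-} · θ_{8,4,+} = θ_{3,1,-} · θ_{12,4,-}²`, i.e.
  `(∑ W^{4m²+2m})(∑ (-1)ⁿ W^{2n²})(∑ W^{8m²+4m}) = (∑ (-1)^k W^{3k²+k})(∑ (-1)^k W^{12k²+4k})²`;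
  both sides are `∏ (1 - W^{2n}) ∏ (1 - W^{8n})²` (Euler's pentagonal theorem for the right side,
  Gauss's `∑ q^{n(n+1)/2} = ∏ (1-q^{2n})/(1-q^{2n-1})` and `∑ (-1)ⁿ qⁿ² = ∏ (1-qⁿ)/(1+qⁿ)` for
  the left side — all instances of Jacobi's triple product).
* `thetaSeries_etaSq_eq` (**`η(12z)² η(24z)² = φ(3z)`**, `φ = η(4z)²η(8z)² = θ-products by
  Jacobi's `θ₁' = θ₂θ₃θ₄`): `θ_{3,1,-}² · θ_{6,2,-}² = θ_{8,4,+} · θ_{2,0,+} · θ_{2,0,-}²`;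
  both sides are `∏ (1 - W^{2n})² ∏ (1 - W^{4n})²`.

As in `TunnellThetaCoefficientsProofs` nothing infinite is formed: each theta factor is congruent
modulo `X^D` to a finite Euler product times a finite Cauchy product
(`eqMod_xPoch_mul_cauchyThetaProd`, the truncated triple product), and the finite products are
regrouped exactly, up to lengthening Euler products (`eqMod_xPoch_of_le`). The file also records
the coefficient formulae for three- and fourfold products of theta series
(`coeff_thetaSeries_mul₃`, `coeff_thetaSeries_mul₄`) used downstream.

## References

* J. B. Tunnell, *A classical Diophantine problem and modular forms of weight 3/2*, Invent. Math.
  72 (1983) 323–334, Thm 2 and its proof, pp. 327–328; Remark p. 327 (Jacobi's product for `g`).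
  [Tunnell1983Congruent]
* G. E. Andrews, *The Theory of Partitions* (1976), Thm 2.8 (Jacobi's triple product), Cor. 1.7
  (Euler's pentagonal number theorem), (2.2.12)–(2.2.13) (Gauss). [Andrews1976Partitions]
-/

namespace Literature.NumberTheory.EllipticCurves.Tunnell1983

open Finset PowerSeries

section Helpers

/-! ### Finite Euler products: splitting by residues, lengthening -/

/-- Splitting a product over `range (3K)` by residues modulo `3`. [folklore] -/
theorem prod_range_three_mul {M : Type*} [CommMonoid M] (f : ℕ → M) (K : ℕ) :
    ∏ i ∈ range (3 * K), f i = ∏ j ∈ range K, (f (3 * j) * f (3 * j + 1) * f (3 * j + 2)) := by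
  induction K with
  | zero => simp
  | succ K ih =>
    rw [show 3 * (K + 1) = 3 * K + 3 by ring, prod_range_add, ih, prod_range_succ]
    simp only [prod_range_succ, prod_range_zero, one_mul, add_zero]

/-- `∏_{i<2K}(1 - X^{c(i+1)}) = ∏_{j<K}(1 - X^{c(2j+1)}) · ∏_{j<K}(1 - X^{2c(j+1)})`: the Euler
product split into odd and even parts. [folklore] -/
theorem xPoch_two_mul (c K : ℕ) :
    xPoch c (2 * K) = (∏ j ∈ range K, (1 - (X : ℤ⟦X⟧) ^ (c * (2 * j + 1)))) * xPoch (2 * c) K := by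
  rw [xPoch, xPoch, prod_range_two_mul, ← prod_mul_distrib]
  refine prod_congr rfl fun j _ ↦ ?_
  ring

/-- `∏_{i<3K}(1 - X^{c(i+1)}) = ∏_{j<K}(1 - X^{c(3j+1)})(1 - X^{c(3j+2)}) · ∏_{j<K}(1 - X^{3c(j+1)})`:
the Euler product split modulo `3`. [folklore] -/
theorem xPoch_three_mul (c K : ℕ) :
    xPoch c (3 * K) = (∏ j ∈ range K, ((1 - (X : ℤ⟦X⟧) ^ (c * (3 * j + 1))) *
      (1 - X ^ (c * (3 * j + 2))))) * xPoch (3 * c) K := by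
  rw [xPoch, xPoch, prod_range_three_mul, ← prod_mul_distrib]
  refine prod_congr rfl fun j _ ↦ ?_
  ring

/-- Two Euler products `(X^c; X^c)_K`, `(X^c; X^c)_{K'}` agree modulo `X^D` once both reach degree
`D`. [folklore] -/
theorem eqMod_xPoch_of_le {c K K' D : ℕ} (hK : D ≤ c * (K + 1)) (hK' : D ≤ c * (K' + 1)) :
    EqMod D (xPoch c K) (xPoch c K') := by
  rcases le_total K K' with h | h
  · obtain ⟨r, rfl⟩ := Nat.exists_eq_add_of_le h
    exact (eqMod_xPoch_add hK).symm
  · obtain ⟨r, rfl⟩ := Nat.exists_eq_add_of_le h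
    exact eqMod_xPoch_add hK'

/-! ### The Cauchy products of the seven theta factors -/

/-- `θ_{4,2,+}`: `∏_{j<K}(1 + X^{8j+6})(1 + X^{8j+2}) = ∏_{i<2K}(1 + X^{2(2i+1)})`. [folklore] -/
theorem cauchyThetaProd_two_two_one (K : ℕ) :
    cauchyThetaProd 2 2 1 K = ∏ i ∈ range (2 * K), (1 + (X : ℤ⟦X⟧) ^ (2 * (2 * i + 1))) := by
  rw [prod_range_two_mul, cauchyThetaProd]
  refine prod_congr rfl fun j _ ↦ ?_
  simp only [map_one]
  ring

/-- `θ_{8,4,+}`: `∏_{j<K}(1 + X^{16j+12})(1 + X^{16j+4}) = ∏_{i<2K}(1 + X^{4(2i+1)})`. [folklore] -/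
theorem cauchyThetaProd_four_four_one (K : ℕ) :
    cauchyThetaProd 4 4 1 K = ∏ i ∈ range (2 * K), (1 + (X : ℤ⟦X⟧) ^ (4 * (2 * i + 1))) := by
  rw [prod_range_two_mul, cauchyThetaProd]
  refine prod_congr rfl fun j _ ↦ ?_
  simp only [map_one]
  ring

/-- `θ_{2,0,+}`: `∏_{j<K}(1 + X^{4j+2})²`. [folklore] -/
theorem cauchyThetaProd_zero_two_one (K : ℕ) :
    cauchyThetaProd 0 2 1 K
      = ∏ j ∈ range K, ((1 + (X : ℤ⟦X⟧) ^ (4 * j + 2)) * (1 + X ^ (4 * j + 2))) := by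
  rw [cauchyThetaProd]
  refine prod_congr rfl fun j _ ↦ ?_
  simp only [map_one]
  ring

/-- `θ_{3,1,-}` (Euler's pentagonal series in `X²`): `∏_{j<K}(1 - X^{6j+4})(1 - X^{6j+2})
= ∏_{j<K}(1 - X^{2(3j+1)})(1 - X^{2(3j+2)})`. [folklore] -/
theorem cauchyThetaProd_one_two_neg (K : ℕ) :
    cauchyThetaProd 1 2 (-1) K
      = ∏ j ∈ range K, ((1 - (X : ℤ⟦X⟧) ^ (2 * (3 * j + 1))) * (1 - X ^ (2 * (3 * j + 2)))) := by
  rw [cauchyThetaProd]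
  refine prod_congr rfl fun j _ ↦ ?_
  simp only [map_neg, map_one]
  ring

/-- `θ_{6,2,-}` (Euler's series in `X⁴`): `∏_{j<K}(1 - X^{12j+8})(1 - X^{12j+4})
= ∏_{j<K}(1 - X^{4(3j+1)})(1 - X^{4(3j+2)})`. [folklore] -/
theorem cauchyThetaProd_two_four_neg (K : ℕ) :
    cauchyThetaProd 2 4 (-1) K
      = ∏ j ∈ range K, ((1 - (X : ℤ⟦X⟧) ^ (4 * (3 * j + 1))) * (1 - X ^ (4 * (3 * j + 2)))) := by
  rw [cauchyThetaProd]
  refine prod_congr rfl fun j _ ↦ ?_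
  simp only [map_neg, map_one]
  ring

/-- `θ_{12,4,-}` (Euler's series in `X⁸`): `∏_{j<K}(1 - X^{24j+16})(1 - X^{24j+8})
= ∏_{j<K}(1 - X^{8(3j+1)})(1 - X^{8(3j+2)})`. [folklore] -/
theorem cauchyThetaProd_four_eight_neg (K : ℕ) :
    cauchyThetaProd 4 8 (-1) K
      = ∏ j ∈ range K, ((1 - (X : ℤ⟦X⟧) ^ (8 * (3 * j + 1))) * (1 - X ^ (8 * (3 * j + 2)))) := by
  rw [cauchyThetaProd]
  refine prod_congr rfl fun j _ ↦ ?_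
  simp only [map_neg, map_one]
  ring

/-- Euler in `X²`: `(X⁶;X⁶)_K · ∏_{j<K}(1 - X^{6j+4})(1 - X^{6j+2}) = (X²;X²)_{3K}`. [folklore] -/
theorem xPoch_mul_cauchyThetaProd_one_two_neg (K : ℕ) :
    xPoch 6 K * cauchyThetaProd 1 2 (-1) K = xPoch 2 (3 * K) := by
  rw [cauchyThetaProd_one_two_neg, xPoch_three_mul, mul_comm]

/-- Euler in `X⁴`: `(X¹²;X¹²)_K · ∏_{j<K}(1 - X^{12j+8})(1 - X^{12j+4}) = (X⁴;X⁴)_{3K}`. [folklore] -/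
theorem xPoch_mul_cauchyThetaProd_two_four_neg (K : ℕ) :
    xPoch 12 K * cauchyThetaProd 2 4 (-1) K = xPoch 4 (3 * K) := by
  rw [cauchyThetaProd_two_four_neg, xPoch_three_mul, mul_comm]

/-- Euler in `X⁸`: `(X²⁴;X²⁴)_K · ∏_{j<K}(1 - X^{24j+16})(1 - X^{24j+8}) = (X⁸;X⁸)_{3K}`. [folklore] -/
theorem xPoch_mul_cauchyThetaProd_four_eight_neg (K : ℕ) :
    xPoch 24 K * cauchyThetaProd 4 8 (-1) K = xPoch 8 (3 * K) := by
  rw [cauchyThetaProd_four_eight_neg, xPoch_three_mul, mul_comm]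

end Helpers

section Identities

/-! ### `g(θ₂ - θ₈) = 2 η(8z) η(32z)²` as a theta-series identity -/

/-- **`θ_{4,2,+} θ_{2,0,-} θ_{8,4,+} = θ_{3,1,-} θ_{12,4,-}²`** in `ℤ⟦W⟧`:
`(∑ W^{4m²+2m})(∑ (-1)ⁿ W^{2n²})(∑ W^{8m²+4m}) = (∑ (-1)^k W^{3k²+k})(∑ (-1)^k W^{12k²+4k})²`
— with `W = q⁴` and after multiplying by `2q³` this is `g(θ₂ - θ₈) = ½(θ₁-θ₄)(2θ₃₂-θ₈)(θ₂-θ₈)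
= 2 η(8z) η(32z)²` expanded by Euler's pentagonal theorem `η(24z) = ∑ χ₁₂(n) q^{n²}`; both sides
are `∏ (1 - W^{2n}) ∏ (1 - W^{8n})²` by five truncated triple products.
[cite: Tunnell1983Congruent, proof of Thm 2, pp. 327–328; Andrews1976Partitions, Thm 2.8, Cor. 1.7] -/
theorem thetaSeries_classThree_eq :
    thetaSeries 2 2 1 * thetaSeries 0 2 (-1) * thetaSeries 4 4 1 =
      thetaSeries 1 2 (-1) * thetaSeries 4 8 (-1) * thetaSeries 4 8 (-1) := by
  refine eq_of_forall_eqMod_succ fun D' ↦ ?_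
  set D := D' + 1
  have hD : 0 < D := Nat.succ_pos D'
  have h1 := eqMod_xPoch_mul_cauchyThetaProd (b := 2) (e := 2) (s := 1) (by norm_num)
    (by norm_num) hD (N := 2 * D) (M := 4 * D) (by omega) (by omega)
  have h2 := eqMod_xPoch_mul_cauchyThetaProd (b := 0) (e := 2) (s := -1) (by norm_num)
    (by norm_num) hD (N := 4 * D) (M := 4 * D + D) (by omega) (by omega)
  have h3 := eqMod_xPoch_mul_cauchyThetaProd (b := 4) (e := 4) (s := 1) (by norm_num)
    (by norm_num) hD (N := 2 * D) (M := 4 * D) (by omega) (by omega)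
  have h4 := eqMod_xPoch_mul_cauchyThetaProd (b := 1) (e := 2) (s := -1) (by norm_num)
    (by norm_num) hD (N := 2 * D) (M := 2 * D + D) (by omega) (by omega)
  have h5 := eqMod_xPoch_mul_cauchyThetaProd (b := 4) (e := 8) (s := -1) (by norm_num)
    (by norm_num) hD (N := 2 * D) (M := 2 * D + D) (by omega) (by omega)
  rw [show 2 * (2 + 2) = 8 from rfl, cauchyThetaProd_two_two_one,
    show 2 * (2 * D) = 4 * D by ring] at h1
  rw [show 2 * (0 + 2) = 4 from rfl, cauchyThetaProd_zero_two] at h2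
  rw [show 2 * (4 + 4) = 16 from rfl, cauchyThetaProd_four_four_one,
    show 2 * (2 * D) = 4 * D by ring] at h3
  rw [show 2 * (1 + 2) = 6 from rfl] at h4
  rw [show 2 * (4 + 8) = 24 from rfl] at h5
  -- names for the finite products
  set x8 := xPoch 8 (4 * D) with hx8
  set x4 := xPoch 4 (4 * D) with hx4
  set x16 := xPoch 16 (4 * D) with hx16
  set P₁ := ∏ i ∈ range (4 * D), (1 + (X : ℤ⟦X⟧) ^ (2 * (2 * i + 1))) with hP₁
  set Q := ∏ j ∈ range (4 * D), ((1 - (X : ℤ⟦X⟧) ^ (4 * j + 2)) * (1 - X ^ (4 * j + 2))) with hQ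
  set P₃ := ∏ i ∈ range (4 * D), (1 + (X : ℤ⟦X⟧) ^ (4 * (2 * i + 1))) with hP₃
  set A₂ := ∏ i ∈ range (4 * D), (1 - (X : ℤ⟦X⟧) ^ (2 * (2 * i + 1))) with hA₂
  set A₄ := ∏ i ∈ range (4 * D), (1 - (X : ℤ⟦X⟧) ^ (4 * (2 * i + 1))) with hA₄
  set A₈ := ∏ i ∈ range (4 * D), (1 - (X : ℤ⟦X⟧) ^ (8 * (2 * i + 1))) with hA₈
  -- exact regrouping of the left side
  have key1 : P₁ * Q = A₄ * A₂ := by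
    rw [hP₁, hQ, hA₄, hA₂, ← prod_mul_distrib, ← prod_mul_distrib]
    refine prod_congr rfl fun i _ ↦ ?_
    ring
  have key2 : A₄ * P₃ = A₈ := by
    rw [hA₄, hP₃, hA₈, ← prod_mul_distrib]
    refine prod_congr rfl fun i _ ↦ ?_
    ring
  have key3 : A₈ * x16 = xPoch 8 (8 * D) := by
    rw [hA₈, hx16, show 8 * D = 2 * (4 * D) by ring, xPoch_two_mul]
  have key4 : A₂ * x4 = xPoch 2 (8 * D) := by
    rw [hA₂, hx4, show 8 * D = 2 * (4 * D) by ring, xPoch_two_mul]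
  have hx4' : EqMod D (xPoch 4 (4 * D + D)) x4 := eqMod_xPoch_add (by omega)
  have hL1 : EqMod D (thetaSeries 2 2 1 * thetaSeries 0 2 (-1) * thetaSeries 4 4 1)
      ((x8 * P₁) * (xPoch 4 (4 * D + D) * Q) * (x16 * P₃)) := ((h1.mul h2).mul h3).symm
  have hL2 : EqMod D ((x8 * P₁) * (xPoch 4 (4 * D + D) * Q) * (x16 * P₃))
      ((x8 * P₁) * (x4 * Q) * (x16 * P₃)) :=
    ((EqMod.refl _ _).mul (hx4'.mul (EqMod.refl _ _))).mul (EqMod.refl _ _)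
  have hL3 : (x8 * P₁) * (x4 * Q) * (x16 * P₃) = x8 * xPoch 8 (8 * D) * xPoch 2 (8 * D) := by
    linear_combination (x8 * x4 * x16 * P₃) * key1 + (x8 * x4 * x16 * A₂) * key2
      + (x8 * x4 * A₂) * key3 + (x8 * xPoch 8 (8 * D)) * key4
  -- the right side
  have hx6 : EqMod D (xPoch 6 (2 * D + D)) (xPoch 6 (2 * D)) := eqMod_xPoch_add (by omega)
  have hx24 : EqMod D (xPoch 24 (2 * D + D)) (xPoch 24 (2 * D)) := eqMod_xPoch_add (by omega)
  have hR1 : EqMod D (thetaSeries 1 2 (-1) * thetaSeries 4 8 (-1) * thetaSeries 4 8 (-1))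
      ((xPoch 6 (2 * D + D) * cauchyThetaProd 1 2 (-1) (2 * D))
        * (xPoch 24 (2 * D + D) * cauchyThetaProd 4 8 (-1) (2 * D))
        * (xPoch 24 (2 * D + D) * cauchyThetaProd 4 8 (-1) (2 * D))) := ((h4.mul h5).mul h5).symm
  have hR2 : EqMod D ((xPoch 6 (2 * D + D) * cauchyThetaProd 1 2 (-1) (2 * D))
        * (xPoch 24 (2 * D + D) * cauchyThetaProd 4 8 (-1) (2 * D))
        * (xPoch 24 (2 * D + D) * cauchyThetaProd 4 8 (-1) (2 * D)))
      ((xPoch 6 (2 * D) * cauchyThetaProd 1 2 (-1) (2 * D))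
        * (xPoch 24 (2 * D) * cauchyThetaProd 4 8 (-1) (2 * D))
        * (xPoch 24 (2 * D) * cauchyThetaProd 4 8 (-1) (2 * D))) :=
    ((hx6.mul (EqMod.refl _ _)).mul (hx24.mul (EqMod.refl _ _))).mul (hx24.mul (EqMod.refl _ _))
  have hR3 : (xPoch 6 (2 * D) * cauchyThetaProd 1 2 (-1) (2 * D))
        * (xPoch 24 (2 * D) * cauchyThetaProd 4 8 (-1) (2 * D))
        * (xPoch 24 (2 * D) * cauchyThetaProd 4 8 (-1) (2 * D))
      = xPoch 2 (6 * D) * xPoch 8 (6 * D) * xPoch 8 (6 * D) := by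
    rw [xPoch_mul_cauchyThetaProd_one_two_neg, xPoch_mul_cauchyThetaProd_four_eight_neg,
      show 3 * (2 * D) = 6 * D by ring]
  -- common normal form
  have e8a : EqMod D x8 (xPoch 8 (6 * D)) := eqMod_xPoch_of_le (by omega) (by omega)
  have e8b : EqMod D (xPoch 8 (8 * D)) (xPoch 8 (6 * D)) := eqMod_xPoch_of_le (by omega) (by omega)
  have e2 : EqMod D (xPoch 2 (8 * D)) (xPoch 2 (6 * D)) := eqMod_xPoch_of_le (by omega) (by omega)
  have hNF : EqMod D (x8 * xPoch 8 (8 * D) * xPoch 2 (8 * D))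
      (xPoch 2 (6 * D) * xPoch 8 (6 * D) * xPoch 8 (6 * D)) := by
    have h := (e8a.mul e8b).mul e2
    rwa [show xPoch 8 (6 * D) * xPoch 8 (6 * D) * xPoch 2 (6 * D)
      = xPoch 2 (6 * D) * xPoch 8 (6 * D) * xPoch 8 (6 * D) by ring] at h
  have hL : EqMod D (thetaSeries 2 2 1 * thetaSeries 0 2 (-1) * thetaSeries 4 4 1)
      (xPoch 2 (6 * D) * xPoch 8 (6 * D) * xPoch 8 (6 * D)) :=
    hL1.trans (hL2.trans (by rw [hL3]; exact hNF))
  have hR : EqMod D (thetaSeries 1 2 (-1) * thetaSeries 4 8 (-1) * thetaSeries 4 8 (-1))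
      (xPoch 2 (6 * D) * xPoch 8 (6 * D) * xPoch 8 (6 * D)) :=
    hR1.trans (hR2.trans (by rw [hR3]; exact EqMod.refl _ _))
  exact hL.trans hR.symm

/-! ### `η(12z)² η(24z)² = φ(3z)` as a theta-series identity -/

/-- **`θ_{3,1,-}² θ_{6,2,-}² = θ_{8,4,+} θ_{2,0,+} θ_{2,0,-}²`** in `ℤ⟦W⟧`:
`(∑ (-1)^k W^{3k²+k})² (∑ (-1)^k W^{6k²+2k})² = (∑ W^{8m²+4m})(∑ W^{2n²})(∑ (-1)ⁿ W^{2n²})²`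
— with `W = q⁴` this is `η(24z)²η(48z)² = φ(6z)` (times `q⁶`), `φ = η(4z)²η(8z)²
= ½(θ₁ - θ₄) θ₄ θ̃₄²` the level-`32` newform of `E : y² = x³ - x`; both sides are
`∏ (1 - W^{2n})² ∏ (1 - W^{4n})²` by seven truncated triple products.
[cite: Tunnell1983Congruent, proof of Thm 2, pp. 325, 327–328; Andrews1976Partitions, Thm 2.8, Cor. 1.7] -/
theorem thetaSeries_etaSq_eq :
    thetaSeries 1 2 (-1) * thetaSeries 1 2 (-1) * thetaSeries 2 4 (-1) * thetaSeries 2 4 (-1) =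
      thetaSeries 4 4 1 * thetaSeries 0 2 1 * thetaSeries 0 2 (-1) * thetaSeries 0 2 (-1) := by
  refine eq_of_forall_eqMod_succ fun D' ↦ ?_
  set D := D' + 1
  have hD : 0 < D := Nat.succ_pos D'
  have h4 := eqMod_xPoch_mul_cauchyThetaProd (b := 1) (e := 2) (s := -1) (by norm_num)
    (by norm_num) hD (N := 2 * D) (M := 2 * D + D) (by omega) (by omega)
  have h6 := eqMod_xPoch_mul_cauchyThetaProd (b := 2) (e := 4) (s := -1) (by norm_num)
    (by norm_num) hD (N := 2 * D) (M := 2 * D + D) (by omega) (by omega)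
  have h3 := eqMod_xPoch_mul_cauchyThetaProd (b := 4) (e := 4) (s := 1) (by norm_num)
    (by norm_num) hD (N := 2 * D) (M := 4 * D) (by omega) (by omega)
  have h7 := eqMod_xPoch_mul_cauchyThetaProd (b := 0) (e := 2) (s := 1) (by norm_num)
    (by norm_num) hD (N := 4 * D) (M := 4 * D + D) (by omega) (by omega)
  have h2 := eqMod_xPoch_mul_cauchyThetaProd (b := 0) (e := 2) (s := -1) (by norm_num)
    (by norm_num) hD (N := 4 * D) (M := 4 * D + D) (by omega) (by omega)
  rw [show 2 * (1 + 2) = 6 from rfl] at h4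
  rw [show 2 * (2 + 4) = 12 from rfl] at h6
  rw [show 2 * (4 + 4) = 16 from rfl, cauchyThetaProd_four_four_one,
    show 2 * (2 * D) = 4 * D by ring] at h3
  rw [show 2 * (0 + 2) = 4 from rfl, cauchyThetaProd_zero_two_one] at h7
  rw [show 2 * (0 + 2) = 4 from rfl, cauchyThetaProd_zero_two] at h2
  -- the left side
  have hx6 : EqMod D (xPoch 6 (2 * D + D)) (xPoch 6 (2 * D)) := eqMod_xPoch_add (by omega)
  have hx12 : EqMod D (xPoch 12 (2 * D + D)) (xPoch 12 (2 * D)) := eqMod_xPoch_add (by omega)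
  have hL1 : EqMod D
      (thetaSeries 1 2 (-1) * thetaSeries 1 2 (-1) * thetaSeries 2 4 (-1) * thetaSeries 2 4 (-1))
      ((xPoch 6 (2 * D + D) * cauchyThetaProd 1 2 (-1) (2 * D))
        * (xPoch 6 (2 * D + D) * cauchyThetaProd 1 2 (-1) (2 * D))
        * (xPoch 12 (2 * D + D) * cauchyThetaProd 2 4 (-1) (2 * D))
        * (xPoch 12 (2 * D + D) * cauchyThetaProd 2 4 (-1) (2 * D))) :=
    (((h4.mul h4).mul h6).mul h6).symm
  have hL2 : EqMod D
      ((xPoch 6 (2 * D + D) * cauchyThetaProd 1 2 (-1) (2 * D))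
        * (xPoch 6 (2 * D + D) * cauchyThetaProd 1 2 (-1) (2 * D))
        * (xPoch 12 (2 * D + D) * cauchyThetaProd 2 4 (-1) (2 * D))
        * (xPoch 12 (2 * D + D) * cauchyThetaProd 2 4 (-1) (2 * D)))
      ((xPoch 6 (2 * D) * cauchyThetaProd 1 2 (-1) (2 * D))
        * (xPoch 6 (2 * D) * cauchyThetaProd 1 2 (-1) (2 * D))
        * (xPoch 12 (2 * D) * cauchyThetaProd 2 4 (-1) (2 * D))
        * (xPoch 12 (2 * D) * cauchyThetaProd 2 4 (-1) (2 * D))) :=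
    (((hx6.mul (EqMod.refl _ _)).mul (hx6.mul (EqMod.refl _ _))).mul
      (hx12.mul (EqMod.refl _ _))).mul (hx12.mul (EqMod.refl _ _))
  have hL3 : (xPoch 6 (2 * D) * cauchyThetaProd 1 2 (-1) (2 * D))
        * (xPoch 6 (2 * D) * cauchyThetaProd 1 2 (-1) (2 * D))
        * (xPoch 12 (2 * D) * cauchyThetaProd 2 4 (-1) (2 * D))
        * (xPoch 12 (2 * D) * cauchyThetaProd 2 4 (-1) (2 * D))
      = xPoch 2 (6 * D) * xPoch 2 (6 * D) * xPoch 4 (6 * D) * xPoch 4 (6 * D) := by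
    rw [xPoch_mul_cauchyThetaProd_one_two_neg, xPoch_mul_cauchyThetaProd_two_four_neg,
      show 3 * (2 * D) = 6 * D by ring]
  -- the right side: names
  set x4 := xPoch 4 (4 * D) with hx4
  set x16 := xPoch 16 (4 * D) with hx16
  set P₃ := ∏ i ∈ range (4 * D), (1 + (X : ℤ⟦X⟧) ^ (4 * (2 * i + 1))) with hP₃
  set S := ∏ j ∈ range (4 * D), ((1 + (X : ℤ⟦X⟧) ^ (4 * j + 2)) * (1 + X ^ (4 * j + 2))) with hS
  set Q := ∏ j ∈ range (4 * D), ((1 - (X : ℤ⟦X⟧) ^ (4 * j + 2)) * (1 - X ^ (4 * j + 2))) with hQ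
  set A₂ := ∏ i ∈ range (4 * D), (1 - (X : ℤ⟦X⟧) ^ (2 * (2 * i + 1))) with hA₂
  set A₄ := ∏ i ∈ range (4 * D), (1 - (X : ℤ⟦X⟧) ^ (4 * (2 * i + 1))) with hA₄
  set A₈ := ∏ i ∈ range (4 * D), (1 - (X : ℤ⟦X⟧) ^ (8 * (2 * i + 1))) with hA₈
  have k1 : S * Q = A₄ * A₄ := by
    rw [hS, hQ, hA₄, ← prod_mul_distrib, ← prod_mul_distrib]
    refine prod_congr rfl fun i _ ↦ ?_
    ring
  have k2 : Q = A₂ * A₂ := by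
    rw [hQ, hA₂, ← prod_mul_distrib]
    refine prod_congr rfl fun i _ ↦ ?_
    ring
  have k3 : A₄ * P₃ = A₈ := by
    rw [hA₄, hP₃, hA₈, ← prod_mul_distrib]
    refine prod_congr rfl fun i _ ↦ ?_
    ring
  have k4 : A₈ * x16 = xPoch 8 (8 * D) := by
    rw [hA₈, hx16, show 8 * D = 2 * (4 * D) by ring, xPoch_two_mul]
  have k5 : A₂ * x4 = xPoch 2 (8 * D) := by
    rw [hA₂, hx4, show 8 * D = 2 * (4 * D) by ring, xPoch_two_mul]
  have k6 : A₄ * xPoch 8 (4 * D) = xPoch 4 (8 * D) := by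
    rw [hA₄, show 8 * D = 2 * (4 * D) by ring, xPoch_two_mul]
  have hx4' : EqMod D (xPoch 4 (4 * D + D)) x4 := eqMod_xPoch_add (by omega)
  have hR1 : EqMod D
      (thetaSeries 4 4 1 * thetaSeries 0 2 1 * thetaSeries 0 2 (-1) * thetaSeries 0 2 (-1))
      ((x16 * P₃) * (xPoch 4 (4 * D + D) * S) * (xPoch 4 (4 * D + D) * Q)
        * (xPoch 4 (4 * D + D) * Q)) := (((h3.mul h7).mul h2).mul h2).symm
  have hR2 : EqMod D
      ((x16 * P₃) * (xPoch 4 (4 * D + D) * S) * (xPoch 4 (4 * D + D) * Q)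
        * (xPoch 4 (4 * D + D) * Q))
      ((x16 * P₃) * (x4 * S) * (x4 * Q) * (x4 * Q)) :=
    (((EqMod.refl _ _).mul (hx4'.mul (EqMod.refl _ _))).mul (hx4'.mul (EqMod.refl _ _))).mul
      (hx4'.mul (EqMod.refl _ _))
  have hR3 : (x16 * P₃) * (x4 * S) * (x4 * Q) * (x4 * Q)
      = xPoch 8 (8 * D) * A₄ * xPoch 2 (8 * D) * xPoch 2 (8 * D) * x4 := by
    linear_combination (x16 * x4 * x4 * x4 * P₃ * Q) * k1
      + (x16 * x4 * x4 * x4 * P₃ * A₄ * A₄) * k2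
      + (x16 * x4 * x4 * x4 * A₄ * A₂ * A₂) * k3
      + (x4 * x4 * x4 * A₄ * A₂ * A₂) * k4
      + (xPoch 8 (8 * D) * A₄ * x4 * x4 * A₂) * k5
      + (xPoch 8 (8 * D) * A₄ * x4 * xPoch 2 (8 * D)) * k5
  have e8 : EqMod D (xPoch 8 (8 * D)) (xPoch 8 (4 * D)) := eqMod_xPoch_of_le (by omega) (by omega)
  have hR4 : EqMod D (xPoch 8 (8 * D) * A₄ * xPoch 2 (8 * D) * xPoch 2 (8 * D) * x4)
      (xPoch 8 (4 * D) * A₄ * xPoch 2 (8 * D) * xPoch 2 (8 * D) * x4) :=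
    (((e8.mul (EqMod.refl _ _)).mul (EqMod.refl _ _)).mul (EqMod.refl _ _)).mul (EqMod.refl _ _)
  have hR5 : xPoch 8 (4 * D) * A₄ * xPoch 2 (8 * D) * xPoch 2 (8 * D) * x4
      = xPoch 4 (8 * D) * xPoch 2 (8 * D) * xPoch 2 (8 * D) * x4 := by
    rw [mul_comm (xPoch 8 (4 * D)) A₄, k6]
  -- common normal form
  have e4a : EqMod D (xPoch 4 (8 * D)) (xPoch 4 (6 * D)) := eqMod_xPoch_of_le (by omega) (by omega)
  have e4b : EqMod D x4 (xPoch 4 (6 * D)) := eqMod_xPoch_of_le (by omega) (by omega)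
  have e2 : EqMod D (xPoch 2 (8 * D)) (xPoch 2 (6 * D)) := eqMod_xPoch_of_le (by omega) (by omega)
  have hNF : EqMod D (xPoch 4 (8 * D) * xPoch 2 (8 * D) * xPoch 2 (8 * D) * x4)
      (xPoch 2 (6 * D) * xPoch 2 (6 * D) * xPoch 4 (6 * D) * xPoch 4 (6 * D)) := by
    have h := ((e4a.mul e2).mul e2).mul e4b
    rwa [show xPoch 4 (6 * D) * xPoch 2 (6 * D) * xPoch 2 (6 * D) * xPoch 4 (6 * D)
      = xPoch 2 (6 * D) * xPoch 2 (6 * D) * xPoch 4 (6 * D) * xPoch 4 (6 * D) by ring] at h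
  have hL : EqMod D
      (thetaSeries 1 2 (-1) * thetaSeries 1 2 (-1) * thetaSeries 2 4 (-1) * thetaSeries 2 4 (-1))
      (xPoch 2 (6 * D) * xPoch 2 (6 * D) * xPoch 4 (6 * D) * xPoch 4 (6 * D)) :=
    hL1.trans (hL2.trans (by rw [hL3]; exact EqMod.refl _ _))
  have hR : EqMod D
      (thetaSeries 4 4 1 * thetaSeries 0 2 1 * thetaSeries 0 2 (-1) * thetaSeries 0 2 (-1))
      (xPoch 2 (6 * D) * xPoch 2 (6 * D) * xPoch 4 (6 * D) * xPoch 4 (6 * D)) :=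
    hR1.trans (hR2.trans (by rw [hR3]; exact hR4.trans (by rw [hR5]; exact hNF)))
  exact hL.trans hR.symm

end Identities

section Coefficients

/-! ### Coefficients of three- and fourfold products of theta series -/

variable {b₁ e₁ b₂ e₂ b₃ e₃ b₄ e₄ : ℕ}

/-- **Coefficients of a product of three theta series**:
`[X^N] θ₁ θ₂ θ₃ = ∑_{E₁(m) + E₂(k) + E₃(l) = N} s₁^{|m|} s₂^{|k|} s₃^{|l|}` over the box. [folklore] -/
theorem coeff_thetaSeries_mul₃ (h₁ : 1 ≤ e₁) (h₂ : 1 ≤ e₂) (h₃ : 1 ≤ e₃) (s₁ s₂ s₃ : ℤ) (N : ℕ) :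
    coeff N (thetaSeries b₁ e₁ s₁ * thetaSeries b₂ e₂ s₂ * thetaSeries b₃ e₃ s₃) =
      ∑ q ∈ ((box N ×ˢ box N) ×ˢ box N).filter
          (fun q : (ℤ × ℤ) × ℤ ↦
            thetaExp b₁ e₁ q.1.1 + thetaExp b₂ e₂ q.1.2 + thetaExp b₃ e₃ q.2 = N),
        s₁ ^ q.1.1.natAbs * s₂ ^ q.1.2.natAbs * s₃ ^ q.2.natAbs := by
  have h := ((thetaSeries_eqMod_finsum (b := b₁) h₁ s₁ N).mul
    (thetaSeries_eqMod_finsum (b := b₂) h₂ s₂ N)).mul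
    (thetaSeries_eqMod_finsum (b := b₃) h₃ s₃ N)
  rw [h N (Nat.lt_succ_self N), sum_mul_sum, ← sum_product', sum_mul_sum, ← sum_product',
    map_sum, sum_filter]
  refine sum_congr rfl fun q _ ↦ ?_
  rw [show C (s₁ ^ q.1.1.natAbs) * (X : ℤ⟦X⟧) ^ thetaExp b₁ e₁ q.1.1
        * (C (s₂ ^ q.1.2.natAbs) * X ^ thetaExp b₂ e₂ q.1.2)
        * (C (s₃ ^ q.2.natAbs) * X ^ thetaExp b₃ e₃ q.2)
      = C (s₁ ^ q.1.1.natAbs * s₂ ^ q.1.2.natAbs * s₃ ^ q.2.natAbs)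
        * X ^ (thetaExp b₁ e₁ q.1.1 + thetaExp b₂ e₂ q.1.2 + thetaExp b₃ e₃ q.2) by
    rw [map_mul, map_mul, pow_add, pow_add]; ring, coeff_C_mul, coeff_X_pow]
  by_cases hN : thetaExp b₁ e₁ q.1.1 + thetaExp b₂ e₂ q.1.2 + thetaExp b₃ e₃ q.2 = N
  · rw [if_pos hN.symm, if_pos hN, mul_one]
  · rw [if_neg (Ne.symm hN), if_neg hN, mul_zero]

/-- **Coefficients of a product of four theta series**:
`[X^N] θ₁ θ₂ θ₃ θ₄ = ∑_{E₁(m) + E₂(k) + E₃(l) + E₄(n) = N} s₁^{|m|} s₂^{|k|} s₃^{|l|} s₄^{|n|}`.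
[folklore] -/
theorem coeff_thetaSeries_mul₄ (h₁ : 1 ≤ e₁) (h₂ : 1 ≤ e₂) (h₃ : 1 ≤ e₃) (h₄ : 1 ≤ e₄)
    (s₁ s₂ s₃ s₄ : ℤ) (N : ℕ) :
    coeff N (thetaSeries b₁ e₁ s₁ * thetaSeries b₂ e₂ s₂ * thetaSeries b₃ e₃ s₃
        * thetaSeries b₄ e₄ s₄) =
      ∑ q ∈ (((box N ×ˢ box N) ×ˢ box N) ×ˢ box N).filter
          (fun q : ((ℤ × ℤ) × ℤ) × ℤ ↦
            thetaExp b₁ e₁ q.1.1.1 + thetaExp b₂ e₂ q.1.1.2 + thetaExp b₃ e₃ q.1.2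
              + thetaExp b₄ e₄ q.2 = N),
        s₁ ^ q.1.1.1.natAbs * s₂ ^ q.1.1.2.natAbs * s₃ ^ q.1.2.natAbs * s₄ ^ q.2.natAbs := by
  have h := (((thetaSeries_eqMod_finsum (b := b₁) h₁ s₁ N).mul
    (thetaSeries_eqMod_finsum (b := b₂) h₂ s₂ N)).mul
    (thetaSeries_eqMod_finsum (b := b₃) h₃ s₃ N)).mul
    (thetaSeries_eqMod_finsum (b := b₄) h₄ s₄ N)
  rw [h N (Nat.lt_succ_self N), sum_mul_sum, ← sum_product', sum_mul_sum, ← sum_product',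
    sum_mul_sum, ← sum_product', map_sum, sum_filter]
  refine sum_congr rfl fun q _ ↦ ?_
  rw [show C (s₁ ^ q.1.1.1.natAbs) * (X : ℤ⟦X⟧) ^ thetaExp b₁ e₁ q.1.1.1
        * (C (s₂ ^ q.1.1.2.natAbs) * X ^ thetaExp b₂ e₂ q.1.1.2)
        * (C (s₃ ^ q.1.2.natAbs) * X ^ thetaExp b₃ e₃ q.1.2)
        * (C (s₄ ^ q.2.natAbs) * X ^ thetaExp b₄ e₄ q.2)
      = C (s₁ ^ q.1.1.1.natAbs * s₂ ^ q.1.1.2.natAbs * s₃ ^ q.1.2.natAbs * s₄ ^ q.2.natAbs)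
        * X ^ (thetaExp b₁ e₁ q.1.1.1 + thetaExp b₂ e₂ q.1.1.2 + thetaExp b₃ e₃ q.1.2
          + thetaExp b₄ e₄ q.2) by
    rw [map_mul, map_mul, map_mul, pow_add, pow_add, pow_add]; ring, coeff_C_mul, coeff_X_pow]
  by_cases hN : thetaExp b₁ e₁ q.1.1.1 + thetaExp b₂ e₂ q.1.1.2 + thetaExp b₃ e₃ q.1.2
      + thetaExp b₄ e₄ q.2 = N
  · rw [if_pos hN.symm, if_pos hN, mul_one]
  · rw [if_neg (Ne.symm hN), if_neg hN, mul_zero]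

end Coefficients

end Literature.NumberTheory.EllipticCurves.Tunnell1983
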